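import Literature.NumberTheory.Transcendental.KZRelationsLE
import Literature.NumberTheory.Transcendental.KZLogCalculusProofs
import Literature.NumberTheory.Transcendental.EllIterRep
import Summits.KontsevichZagierPeriods.KontsevichZagierPeriods.Theorems.AbelContractionAbelContractionLemma

/-!
# Route AbelContraction — `RealHyperellipticSector` (crux stmt-KontsevichZagierPeriods-12475): the budget kit

Helper file of the line `Lines/birth.lean` (lead seat, `--supports` the crux): the four moves of the
Kontsevich–Zagier calculus and their first derived rules, stated INSIDE a dimension budget
`KZ.relationsLE d` — each conclusion carries the dimension certificate that the move instance lies
in `KZ.movesLE d` (all representations of dimension `≤ d`; a Newton–Leibniz instance `k + 1 → k`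
needs `k + 1 ≤ d`). These are the `relationsLE`-versions of the tree's `KZ.domainAddRel_subset_relations`,
`KZ.changeOfVariablesRel_subset_relations`, `KZ.newtonLeibnizRel_subset_relations`,
`KZ.of_mem_relations_of_volume_eq_zero`, `KZ.IntegralRep.of_sub_of_restrict_mem_relations`,
`KZ.of_sub_of_mem_relations_of_eqOn` (integrand additivity inside the budget is REUSED from
`AbelContractionLemma.mem_relationsLE_of_integrandAdd`). Every stub of the line (cells, Euler
substitution, the Baker sector port, the engine) builds its chains from this kit; the headline
`split_mem_relationsLE` (registered sub-goal) is the cell-splitting rule: `[σ, f] ≡ [σ ∩ A, f] +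
[σ ∖ A, f]` inside dimension `≤ d` for every `ℚ`-semialgebraic `A`.

References: M. Kontsevich, D. Zagier, *Periods* (2001), §1.2 rules (1)–(3) [KontsevichZagier2001];
the truncation `KZ.relationsLE` is the construction of
`Literature/NumberTheory/Transcendental/KZRelationsLE.lean`. No definitions are introduced.
-/

noncomputable section

open Set MeasureTheory
open Literature.ModelTheory.ExponentialFields
open Literature.NumberTheory.Transcendental Literature.NumberTheory.Transcendental.KZ
open Summit.KontsevichZagierPeriods.AbelContraction.AbelContractionLemma
  (mem_relationsLE_of_integrandAdd of_mem_relationsLE_of_eqOn_zero)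

namespace Summit.KontsevichZagierPeriods.AbelContraction.RealHyperellipticSector.Budget

variable {k d : ℕ}

/-! ## The four moves inside a budget -/

/-- **Rule (1a) inside dimension `≤ d`**: a domain-additivity instance among representations of
dimension `k ≤ d` is a truncated relation, `[r] − [r₁] − [r₂] ∈ relationsLE d`.
[cite: KontsevichZagier2001, §1.2 rule (1)] -/
theorem domainAdd_mem_relationsLE (hk : k ≤ d) {r r₁ r₂ : IntegralRep k}
    (hdom : r.domain = r₁.domain ∪ r₂.domain) (hnull : volume (r₁.domain ∩ r₂.domain) = 0)
    (h₁ : EqOn r.integrand r₁.integrand r₁.domain) (h₂ : EqOn r.integrand r₂.integrand r₂.domain) :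
    of r - of r₁ - of r₂ ∈ relationsLE d := by
  refine movesLE_subset_relationsLE d
    ⟨Or.inl (Or.inl (Or.inl ⟨k, r, r₁, r₂, hdom, hnull, h₁, h₂, rfl⟩)), ?_⟩
  exact sub_mem (sub_mem (of_mem_formalRepLE r hk) (of_mem_formalRepLE r₁ hk))
    (of_mem_formalRepLE r₂ hk)

/-- **Rule (2) inside dimension `≤ d`**: a change-of-variables instance among representations of
dimension `k ≤ d` (hypotheses of `MeasureTheory.integral_image_eq_integral_abs_det_fderiv_smul`:
`Φ` `ℚ`-semialgebraic and injective on `r.domain`, with derivative `Φ' x` within the domain,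
`r'.domain = Φ '' r.domain`, `f = (f' ∘ Φ)·|det Φ'|` on the domain) is a truncated relation,
`[r] − [r'] ∈ relationsLE d`. [cite: KontsevichZagier2001, §1.2 rule (2)] -/
theorem changeOfVariables_mem_relationsLE (hk : k ≤ d) {r r' : IntegralRep k}
    (Φ : (Fin k → ℝ) → (Fin k → ℝ)) (Φ' : (Fin k → ℝ) → (Fin k → ℝ) →L[ℝ] (Fin k → ℝ))
    (hΦ : IsSemialgebraicMapOn ℚ r.domain Φ)
    (hΦ' : ∀ x ∈ r.domain, HasFDerivWithinAt Φ (Φ' x) r.domain x) (hinj : InjOn Φ r.domain)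
    (hdom : r'.domain = Φ '' r.domain)
    (hf : ∀ x ∈ r.domain, r.integrand x = r'.integrand (Φ x) * |(Φ' x).det|) :
    of r - of r' ∈ relationsLE d := by
  refine movesLE_subset_relationsLE d
    ⟨Or.inl (Or.inr ⟨k, r, r', Φ, Φ', hΦ, hΦ', hinj, hdom, hf, rfl⟩), ?_⟩
  exact sub_mem (of_mem_formalRepLE r hk) (of_mem_formalRepLE r' hk)

/-- **Rule (3) inside dimension `≤ d`**: a Newton–Leibniz instance between a band `r` of dimension
`k + 1 ≤ d` and its base `r'` of dimension `k` (data and regularity exactly as in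
`KZ.newtonLeibnizRel`) is a truncated relation, `[r] − [r'] ∈ relationsLE d`.
[cite: KontsevichZagier2001, §1.2 rule (3)] -/
theorem newtonLeibniz_mem_relationsLE (hk : k + 1 ≤ d) {r : IntegralRep (k + 1)} {r' : IntegralRep k}
    (a b : (Fin k → ℝ) → ℝ) (F : (Fin (k + 1) → ℝ) → ℝ)
    (hF : IsSemialgebraicFunOn ℚ r.domain F)
    (ha : IsSemialgebraicFunOn ℚ r'.domain a) (hb : IsSemialgebraicFunOn ℚ r'.domain b)
    (hab : ∀ x ∈ r'.domain, a x ≤ b x)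
    (hdom : r.domain = {z | (Fin.init z : Fin k → ℝ) ∈ r'.domain ∧ a (Fin.init z) ≤ z (Fin.last k) ∧
      z (Fin.last k) ≤ b (Fin.init z)})
    (hcont : ∀ x ∈ r'.domain, ContinuousOn (fun t : ℝ => F (Fin.snoc x t)) (Icc (a x) (b x)))
    (hderiv : ∀ x ∈ r'.domain, ∀ t ∈ Ioo (a x) (b x),
      HasDerivAt (fun s : ℝ => F (Fin.snoc x s)) (r.integrand (Fin.snoc x t)) t)
    (hr' : ∀ x ∈ r'.domain, r'.integrand x = F (Fin.snoc x (b x)) - F (Fin.snoc x (a x))) :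
    of r - of r' ∈ relationsLE d := by
  refine movesLE_subset_relationsLE d
    ⟨Or.inr ⟨k, r, r', a, b, F, hF, ha, hb, hab, hdom, hcont, hderiv, hr', rfl⟩, ?_⟩
  exact sub_mem (of_mem_formalRepLE r hk) (of_mem_formalRepLE r' ((Nat.le_succ k).trans hk))

/-! ## First derived rules inside a budget -/

/-- Soundness inside the budget: a truncated relation has value `0`.
[cite: KontsevichZagier2001, §1.2] -/
theorem eval_eq_zero_of_mem_relationsLE {y : FormalRep} (hy : y ∈ relationsLE d) : eval y = 0 := by
  have h := relations_le_ker_eval_holds (relationsLE_le_relations d hy)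
  rwa [AddMonoidHom.mem_ker] at h

/-- Two representations congruent inside a budget have the same value.
[cite: KontsevichZagier2001, §1.2] -/
theorem value_eq_of_sub_mem_relationsLE {k' : ℕ} {r : IntegralRep k} {r' : IntegralRep k'}
    (h : of r - of r' ∈ relationsLE d) : r.value = r'.value := by
  have h0 := eval_eq_zero_of_mem_relationsLE h
  rwa [map_sub, eval_of, eval_of, sub_eq_zero] at h0

/-- **A representation of dimension `k ≤ d` over a null domain is a truncated relation**
(rule (1a) with `σ = σ ∪ σ`, `σ ∩ σ` null). [cite: KontsevichZagier2001, §1.2 rule (1)] -/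
theorem of_mem_relationsLE_of_volume_eq_zero (hk : k ≤ d) (r : IntegralRep k)
    (h : volume r.domain = 0) : of r ∈ relationsLE d := by
  have h1 : of r - of r - of r ∈ relationsLE d :=
    domainAdd_mem_relationsLE hk (by rw [union_self]) (by rwa [inter_self]) (fun _ _ => rfl)
      fun _ _ => rfl
  have e : of r - of r - of r = -of r := by abel
  rw [e] at h1
  simpa using (relationsLE d).neg_mem h1

/-- **Congruence inside dimension `≤ d`**: two representations of dimension `k ≤ d` with the same
domain whose integrands agree ON the domain differ by a truncated relation (rule (1b) with the
zero representation). [cite: KontsevichZagier2001, §1.2 rule (1)] -/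
theorem congr_mem_relationsLE (hk : k ≤ d) {r r' : IntegralRep k} (hd : r'.domain = r.domain)
    (h : EqOn r.integrand r'.integrand r.domain) : of r - of r' ∈ relationsLE d := by
  obtain ⟨z, hzd, hzi⟩ := exists_zeroRep r.isSemialgebraic_domain
  have h1 : of r - of r' - of z ∈ relationsLE d :=
    mem_relationsLE_of_integrandAdd hk hd hzd fun x hx => by simp [hzi, h hx]
  have h2 : of z ∈ relationsLE d := of_mem_relationsLE_of_eqOn_zero hk z (by simp [hzi, EqOn])
  have e : of r - of r' = (of r - of r' - of z) + of z := by abel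
  rw [e]
  exact (relationsLE d).add_mem h1 h2

/-- **Splitting off a null piece inside dimension `≤ d`**: if `E ⊆ σ` is `ℚ`-semialgebraic and
`σ ∖ E` is null then `[σ, f] − [E, f] ∈ relationsLE d` (rule (1a), the null piece being a
truncated relation). [cite: KontsevichZagier2001, §1.2 rule (1)] -/
theorem of_sub_of_restrict_mem_relationsLE (hk : k ≤ d) (r : IntegralRep k) {E : Set (Fin k → ℝ)}
    (hE : IsSemialgebraic ℚ E) (hEr : E ⊆ r.domain) (hvol : volume (r.domain \ E) = 0) :
    of r - of (r.restrict E hE hEr) ∈ relationsLE d := by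
  have hdiff : IsSemialgebraic ℚ (r.domain \ E) := r.isSemialgebraic_domain.diff hE
  have hsub : r.domain \ E ⊆ r.domain := fun _ hx => hx.1
  have hdom : r.domain =
      (r.restrict E hE hEr).domain ∪ (r.restrict (r.domain \ E) hdiff hsub).domain := by
    ext x
    simp only [IntegralRep.domain_restrict, mem_union, mem_sdiff]
    constructor
    · intro hx
      by_cases hxE : x ∈ E
      · exact Or.inl hxE
      · exact Or.inr ⟨hx, hxE⟩
    · rintro (hx | hx)
      · exact hEr hx
      · exact hx.1
  have hadd : of r - of (r.restrict E hE hEr) - of (r.restrict (r.domain \ E) hdiff hsub) ∈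
      relationsLE d :=
    domainAdd_mem_relationsLE hk hdom (by simp) (fun _ _ => rfl) fun _ _ => rfl
  have hN : of (r.restrict (r.domain \ E) hdiff hsub) ∈ relationsLE d :=
    of_mem_relationsLE_of_volume_eq_zero hk _ hvol
  have := (relationsLE d).add_mem hadd hN
  simpa using this

/-- **Cell splitting inside dimension `≤ d`** (registered sub-goal `split_mem_relationsLE` of crux
stmt-KontsevichZagierPeriods-12475): for a representation `[σ, f]` of dimension `k ≤ d` and any
`ℚ`-semialgebraic `A`, `[σ, f] − [σ ∩ A, f] − [σ ∖ A, f] ∈ relationsLE d` (rule (1a), the two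
pieces being disjoint). [cite: KontsevichZagier2001, §1.2 rule (1)] -/
theorem split_mem_relationsLE : ∀ {k d : ℕ}, k ≤ d → ∀ (r : KZ.IntegralRep k) (A : Set (Fin k → ℝ))
    (hA : IsSemialgebraic ℚ A),
    KZ.of r - KZ.of (r.restrict (r.domain ∩ A) (r.isSemialgebraic_domain.inter hA) inter_subset_left) -
      KZ.of (r.restrict (r.domain \ A) (r.isSemialgebraic_domain.diff hA) sdiff_subset) ∈
        KZ.relationsLE d := by
  intro k d hk r A hA
  refine domainAdd_mem_relationsLE hk ?_ ?_ (fun _ _ => rfl) fun _ _ => rfl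
  · simp only [IntegralRep.domain_restrict, inter_union_sdiff]
  · simp only [IntegralRep.domain_restrict]
    rw [show r.domain ∩ A ∩ (r.domain \ A) = ∅ from
      Set.eq_empty_of_forall_notMem fun x hx => hx.2.2 hx.1.2, measure_empty]

/-- **Restriction to a subdomain of full measure, general form**: if `E ⊆ σ` is
`ℚ`-semialgebraic, then `[σ, f] ≡ [E, f] + [σ ∖ E, f]` inside dimension `≤ d`.
[cite: KontsevichZagier2001, §1.2 rule (1)] -/
theorem of_sub_of_restrict_sub_mem_relationsLE (hk : k ≤ d) (r : IntegralRep k) {E : Set (Fin k → ℝ)}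
    (hE : IsSemialgebraic ℚ E) (hEr : E ⊆ r.domain) :
    of r - of (r.restrict E hE hEr) -
      of (r.restrict (r.domain \ E) (r.isSemialgebraic_domain.diff hE) sdiff_subset) ∈
        relationsLE d := by
  refine domainAdd_mem_relationsLE hk ?_ ?_ (fun _ _ => rfl) fun _ _ => rfl
  · simp only [IntegralRep.domain_restrict, union_sdiff_self]
    exact (union_eq_self_of_subset_left hEr).symm
  · simp only [IntegralRep.domain_restrict, inter_sdiff_self, measure_empty]

/-- **A point domain is a truncated relation in dimension one**: a representation of dimension `1`
whose domain lies in a coordinate hyperplane `{x | x 0 = c}` (a point of the line) lies in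
`relationsLE d` for `1 ≤ d`. [cite: KontsevichZagier2001, §1.2 rule (1)] -/
theorem of_mem_relationsLE_of_subset_point (hd : 1 ≤ d) (r : IntegralRep 1) (c : ℝ)
    (h : r.domain ⊆ {x : Fin 1 → ℝ | x 0 = c}) : of r ∈ relationsLE d := by
  refine of_mem_relationsLE_of_volume_eq_zero hd r (measure_mono_null h ?_)
  rw [volume_pi]
  exact Measure.pi_hyperplane _ _ _

end Summit.KontsevichZagierPeriods.AbelContraction.RealHyperellipticSector.Budget

end
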